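/-
Copyright (c) 2026 the pub-hodgecm-mathlib formalisation cell (harness21).  R90-TF SLAB, section S10 (Rogawski 1990, §13.6–13.8 read at `v`),
prover R90-C138-p07 (g2) — DEAL #35 (R90-C138-plan (g3) RULING J-D7-2 2026-09-05T02:02:09Z): W1-H2′ ∕ W1-H5′ = ★ W1-H2 ∕ ★ W1-H5 with the SMOOTH-GUARDED
read-back (P-e)′; h413 = `stmt-HodgeConjecture-24833`, route `HCCMUnconditional`.
-/
import Summits.HodgeConjecture.HodgeConjecture.Theorems.R90S10RigidityPinLetter     -- ★ p863478 (W1-H5): `GermOfMembersLetter`, `RigidityAtGermLetter`; brings ★ p863346 (W1-H2) `discreteCoeffAtT0_of_exhaustiveCut`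
import Summits.HodgeConjecture.HodgeConjecture.Theorems.R90S10FrozenFamilyMaps      -- ★ p863352 (W1-H3): `S10Frozen.ΦGu`, `unrUnit`, `UnrQs`, the pin ★ `S10Frozen.toAdelic_ΦGu_unrUnit` (guarded by `IsLocSmooth φ`)
import HarnessLib

/-!
# R90-TF ∕ S10 — W1-H2′ ∕ W1-H5′: ROW 6 (D4-d) AT THE FROZEN DATUM WITH THE SMOOTH-GUARDED READ-BACK (P-e)′, AND ITS DISCHARGE AT THE UNIT TEST
# (`Theorems/R90S10FrozenFamilyReadbackSmooth.lean`; ns `Summit.HodgeConjecture.HodgeConjecture.R90.S10`; THEOREMS ONLY — no `def`, no instance, no notation, 0 `sorry`)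

Print: [Rogawski1990] §13.8 display (13.8.3) p. 218 L5–7 («the sum is over cuspidal `π` on `G` such that `ψ_G(t(π)) = t`»), p. 218 L24 («`f = f_u × f_{v′} × f^{u,v′}`»),
p. 219 L2–L3; §13.7 line (3) p. 211.

## WHY (dealer RULING J-D7-2, 02:02:09Z)
★ W1-H2 `discreteCoeffAtT0_frozenDatum` (p863346) and ★ W1-H5 `discreteCoeffAtT0_frozenDatum_of_letters` (p863478) carry the row-D1 read-back (P-e) UNGUARDED:
`he : ∀ φ, toCc (ΦGu e φ) = 𝔣.𝔳.ΦG φ`.  The PAYER of (P-e) at the frozen family of record is ★ W1-H3 `S10Frozen.toAdelic_ΦGu_unrUnit 𝔳 S (hφ : IsLocSmooth φ) :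
toAdelic (𝔳.ΦGu S (unrUnit L S) φ) = 𝔳.ΦG φ` — GUARDED by `IsLocSmooth φ` (the family member reads `φ` through the junk guard ★ `locSmoothPart`, and ★ `S10Frozen.hΦG` pins
`ΦG φ` pointwise only for locally smooth `φ`).  So D ED. 4's twin `stabilisedAtEvp_frozenFamily_of_tfBlocks₂` can discharge `hd4` only through the GUARDED reading
(P-e)′ `he : ∀ φ, IsLocSmooth φ → toCc (ΦGu e φ) = 𝔣.𝔳.ΦG φ`.  The W1-H2 proof uses `he` ONLY under a matched pair `MatchE1 L μ v mHv mQv fH φ`, whose second conjunct IS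
`IsLocSmooth φ` (★ C2 `MatchE1` :145) — so the guarded statement has the SAME proof, with `hM.2.1` fed to `he`.

## CONTENTS (all ★-backed; TRIO)
* `discreteCoeffAtT0_frozenDatum_smooth` — W1-H2′: ★ W1-H2 VERBATIM except `he` guarded by `IsLocSmooth φ`.
* `discreteCoeffAtT0_frozenDatum_of_letters_smooth` — W1-H5′: the same with (P-t₀) ≕ ★ `GermOfMembersLetter 𝔣 evp t₀` and (P-rig) ≕ ★ `RigidityAtGermLetter 𝔣 evp t₀` BY NAME.
* `discreteCoeffAtT0_frozenFamily_unrUnit_of_letters` — (P-e)′ DISCHARGED at the frozen family of record: `toCc := toAdelic`, `ΦGu := 𝔣.𝔳.ΦGu S`, `e := unrUnit L S`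
  (★ `S10Frozen.toAdelic_ΦGu_unrUnit`) — row 6 at the datum's own family modulo (P-t₀) (P-rig) ONLY; what D ED. 4's `hd4` binder consumes at `cD t φ :=
  Σ'_{evp c = t} m(c) · Tr c(toAdelic (𝔣.𝔳.ΦGu S (unrUnit L S) φ))` (row 3's `cD` at the unit, ★ p863191 W1-H1).
HONEST LABEL: ★ helper (`--supports stmt-HodgeConjecture-24833 --as helper`); closes no socket by itself (row 6 stays modulo (P-t₀) (P-rig), whose glue is DEAL #26);
HC_CM is proved only modulo the 7 printed citations (2 remaining named inputs: hLiu418 = `stmt-HodgeConjecture-24832`, h413 = `stmt-HodgeConjecture-24833`) until rung 0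
closes; REL ≠ ★ ≠ BUILT.
-/

set_option autoImplicit false
set_option linter.dupNamespace false

noncomputable section

open scoped RestrictedProduct Matrix MatrixGroups
open Filter MeasureTheory NumberField IsDedekindDomain CompactlySupported
open Literature.NumberTheory.Rogawski1990 Literature.NumberTheory.Automorphic Literature.NumberTheory.Automorphic.UnitaryGroup
open Literature.NumberTheory.Automorphic.UnitaryGroup.CotangentForms Literature.NumberTheory.GaloisRepresentations
open Literature.NumberTheory.Automorphic.Arthur2013.Leaves.TECR
open Summit.HodgeConjecture.HodgeConjecture.Cruxes.H413.K2E1TraceFormulaBeta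
open Summit.HodgeConjecture.HodgeConjecture.Cruxes.H413.K2E1SpectralTermsDiscreteHalf
open Summit.HodgeConjecture.HodgeConjecture.Cruxes.H413.K2E1GlobalTestFunctions

namespace Summit.HodgeConjecture.HodgeConjecture.R90.S10

section Frozen

variable {L : Type} [Field L] [NumberField L] [IsCMField L] [DecidableEq (Pl L)] {μ : HeckeCharacter L} {v : Pl L}
  [MeasurableSpace (HLoc L v)] [BorelSpace (HLoc L v)] [MeasurableSpace (Gqs L v)] [BorelSpace (Gqs L v)]
  {νHv : Measure (HLoc L v)} {νQv : Measure (Gqs L v)} [νHv.IsHaarMeasure] [νHv.IsMulRightInvariant] [νQv.IsHaarMeasure] [νQv.IsMulRightInvariant]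
  [∀ a : HLoc L v, MeasurableSpace (HLoc L v ⧸ Subgroup.centralizer ({a} : Set (HLoc L v)))]
  [∀ a : HLoc L v, BorelSpace (HLoc L v ⧸ Subgroup.centralizer ({a} : Set (HLoc L v)))]
  [∀ γ : Gqs L v, MeasurableSpace (Gqs L v ⧸ Subgroup.centralizer ({γ} : Set (Gqs L v)))]
  [∀ γ : Gqs L v, BorelSpace (Gqs L v ⧸ Subgroup.centralizer ({γ} : Set (Gqs L v)))]
  {mHv : OrbitalMeasureFamily (HLoc L v)} {mQv : OrbitalMeasureFamily (Gqs L v)} {πSt : IrrClass (HLoc L v)}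
  [MeasurableSpace (G3 L).Adelic] [BorelSpace (G3 L).Adelic] [MeasurableSpace (H2 L).Adelic] [BorelSpace (H2 L).Adelic]
  [MeasurableSpace (GArch L)] [BorelSpace (GArch L)] [MeasurableSpace (HArch L)] [BorelSpace (HArch L)]
  [MeasurableSpace (H1Loc L v)] [MeasurableSpace (H1Arch L)] [MeasurableSpace (H1 L).Adelic] [BorelSpace (H1 L).Adelic]

/-- **W1-H2′ — (D4-d) AT THE FROZEN DATUM WITH THE SMOOTH-GUARDED READ-BACK (P-e)′.**  ★ W1-H2 `discreteCoeffAtT0_frozenDatum` token for token, except that the row-D1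
read-back is asked only on LOCALLY SMOOTH `φ`: `he : ∀ φ, IsLocSmooth φ → toCc (ΦGu e φ) = 𝔣.𝔳.ΦG φ` (the shape ★ `S10Frozen.toAdelic_ΦGu_unrUnit` pays).  For every matched
pair `(f^H_v, φ)` (★ `MatchE1`, whose second conjunct is `IsLocSmooth φ`), `Σ'_{c : evp c = t₀} m(c) · Tr c(toCc (ΦGu e φ)) = Σᶠ_i m(π_i) · Tr [P i](𝔳.ΦG φ)`.
PROOF = W1-H2's: ★ `discreteCoeffAtT0_of_exhaustiveCut` at `cl := 𝔣.𝔤.cl`, exhaustiveness from the CORE field `𝔣.𝔤.hexh` through (P-rig), finite support from the CUT field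
`𝔣.𝔤.hsuppG`; every use of `he` sits under the matched pair. [cite: Rogawski1990, §13.8 display (13.8.3) p. 218 L5–7, L24, p. 219 L3; §13.7 line (3) p. 211]
[cite: FlathCorvallis1979, Thm. 3] -/
theorem discreteCoeffAtT0_frozenDatum_smooth (𝔣 : S10FrozenDatum L μ v νHv νQv mHv mQv πSt) {TG Unr Germ : Type*}
    (toCc : TG → C_c((G3 L).Adelic, ℂ)) (ΦGu : Unr → (Gqs L v → ℂ) → TG) (e : Unr) (t₀ : Germ) :
    haveI := 𝔣.𝔤.hμG
    haveI := 𝔣.𝔤.hνG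
    ∀ (evp : DiscreteClass (G3 L) 𝔣.𝔤.μG → Germ),
      -- (P-e)′: at the unit unramified test the frozen family IS the frozen vector, ON LOCALLY SMOOTH `φ` (row D1 read-back, guarded)
      (∀ φ : Gqs L v → ℂ, IsLocSmooth φ → toCc (ΦGu e φ) = 𝔣.𝔳.ΦG φ) →
      -- (P-t₀): every member of the cut has germ `t₀`
      (∀ i : 𝔣.𝔤.ι, evp (𝔣.𝔤.cl i) = t₀) →
      -- (P-rig): a contributing class of germ `t₀` satisfies THE membership predicate (p. 219 L3)
      (∀ c : DiscreteClass (G3 L) 𝔣.𝔤.μG, evp c = t₀ →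
        (∃ (fH : HLoc L v → ℂ) (φ : Gqs L v → ℂ), MatchE1 L μ v mHv mQv fH φ ∧ c.classTrace 𝔣.𝔤.νG (𝔣.𝔳.ΦG φ) ≠ 0) →
          ∃ πc : ∀ w : Pl L, IrrClass (Gqs L w), S10MemG L μ v νHv νQv mHv mQv πSt 𝔣.𝔥 𝔣.𝔳 𝔣.𝔤.μG c πc) →
      ∀ (fH : HLoc L v → ℂ) (φ : Gqs L v → ℂ), MatchE1 L μ v mHv mQv fH φ →
        (∑' q : {c : DiscreteClass (G3 L) 𝔣.𝔤.μG // evp c = t₀}, ((q.1.mult).toNat : ℂ) * q.1.classTrace 𝔣.𝔤.νG (toCc (ΦGu e φ))) =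
          ∑ᶠ i : 𝔣.𝔤.ι, (((DiscreteClass.mk (𝔣.𝔤.P i)).mult).toNat : ℂ) * (DiscreteClass.mk (𝔣.𝔤.P i)).classTrace 𝔣.𝔤.νG (𝔣.𝔳.ΦG φ) := by
  haveI := 𝔣.𝔤.hμG
  haveI := 𝔣.𝔤.hνG
  intro evp he ht₀ hrig
  -- exhaustiveness at `t₀`, `φ`-uniform: the CORE field `hexh` through (P-rig) and (P-e)′ (the matched `φ` is locally smooth)
  have hexh' : ∀ (fH : HLoc L v → ℂ) (φ : Gqs L v → ℂ), MatchE1 L μ v mHv mQv fH φ → ∀ c : DiscreteClass (G3 L) 𝔣.𝔤.μG, evp c = t₀ →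
      c.classTrace 𝔣.𝔤.νG (toCc (ΦGu e φ)) ≠ 0 → c ∈ Set.range 𝔣.𝔤.cl := by
    intro fH φ hM c hc htr
    rw [he φ hM.2.1] at htr
    obtain ⟨πc, hmem⟩ := hrig c hc ⟨fH, φ, hM, htr⟩
    exact 𝔣.𝔤.hexh c πc hmem ⟨fH, φ, hM, htr⟩
  -- the member weights read at the frozen vector through (P-e)′; `𝔣.𝔤.cl i = [P i]` by `rfl`
  have hw : ∀ φ : Gqs L v → ℂ, IsLocSmooth φ →
      (fun i : 𝔣.𝔤.ι => (((𝔣.𝔤.cl i).mult).toNat : ℂ) * (𝔣.𝔤.cl i).classTrace 𝔣.𝔤.νG (toCc (ΦGu e φ))) =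
        fun i : 𝔣.𝔤.ι => (((DiscreteClass.mk (𝔣.𝔤.P i)).mult).toNat : ℂ) * (DiscreteClass.mk (𝔣.𝔤.P i)).classTrace 𝔣.𝔤.νG (𝔣.𝔳.ΦG φ) := by
    intro φ hφ
    funext i
    rw [he φ hφ]
    rfl
  -- finite support: the CUT field `hsuppG` through (P-e)′
  have hfin' : ∀ (fH : HLoc L v → ℂ) (φ : Gqs L v → ℂ), MatchE1 L μ v mHv mQv fH φ →
      (Function.support fun i : 𝔣.𝔤.ι => (((𝔣.𝔤.cl i).mult).toNat : ℂ) * (𝔣.𝔤.cl i).classTrace 𝔣.𝔤.νG (toCc (ΦGu e φ))).Finite := by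
    intro fH φ hM
    rw [hw φ hM.2.1]
    exact 𝔣.𝔤.hsuppG fH φ hM
  intro fH φ hM
  rw [discreteCoeffAtT0_of_exhaustiveCut L v (G3 L) 𝔣.𝔤.μG 𝔣.𝔤.νG toCc ΦGu (MatchE1 L μ v mHv mQv) evp e t₀ 𝔣.𝔤.cl 𝔣.𝔤.hinj ht₀ hexh' hfin' fH φ hM]
  exact congrArg finsum (hw φ hM.2.1)

/-- **W1-H5′ — THE READING WITH THE TWO E.V.P. PINS CITED BY NAME, SMOOTH-GUARDED (P-e)′**: `discreteCoeffAtT0_frozenDatum_smooth` with (P-t₀) := ★ `GermOfMembersLetter 𝔣 evp t₀`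
and (P-rig) := ★ `RigidityAtGermLetter 𝔣 evp t₀` (definitional unfolding, as in ★ W1-H5). [cite: Rogawski1990, §13.8 display (13.8.3) p. 218 L5–7, p. 219 L3; §13.7 line (3) p. 211]
[cite: FlathCorvallis1979, Thm. 3] -/
theorem discreteCoeffAtT0_frozenDatum_of_letters_smooth (𝔣 : S10FrozenDatum L μ v νHv νQv mHv mQv πSt) {TG Unr Germ : Type*}
    (toCc : TG → C_c((G3 L).Adelic, ℂ)) (ΦGu : Unr → (Gqs L v → ℂ) → TG) (e : Unr) (t₀ : Germ)
    (evp : (haveI := 𝔣.𝔤.hμG; DiscreteClass (G3 L) 𝔣.𝔤.μG) → Germ)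
    (he : ∀ φ : Gqs L v → ℂ, IsLocSmooth φ → toCc (ΦGu e φ) = 𝔣.𝔳.ΦG φ)
    (ht₀ : GermOfMembersLetter 𝔣 evp t₀) (hrig : RigidityAtGermLetter 𝔣 evp t₀) :
    haveI := 𝔣.𝔤.hμG
    haveI := 𝔣.𝔤.hνG
    ∀ (fH : HLoc L v → ℂ) (φ : Gqs L v → ℂ), MatchE1 L μ v mHv mQv fH φ →
      (∑' q : {c : DiscreteClass (G3 L) 𝔣.𝔤.μG // evp c = t₀}, ((q.1.mult).toNat : ℂ) * q.1.classTrace 𝔣.𝔤.νG (toCc (ΦGu e φ))) =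
        ∑ᶠ i : 𝔣.𝔤.ι, (((DiscreteClass.mk (𝔣.𝔤.P i)).mult).toNat : ℂ) * (DiscreteClass.mk (𝔣.𝔤.P i)).classTrace 𝔣.𝔤.νG (𝔣.𝔳.ΦG φ) :=
  discreteCoeffAtT0_frozenDatum_smooth 𝔣 toCc ΦGu e t₀ evp he ht₀ hrig

/-- **ROW 6 AT THE FROZEN FAMILY OF RECORD — (P-e)′ DISCHARGED**: at `toCc := toAdelic`, `ΦGu := 𝔣.𝔳.ΦGu S` (★ W1-H3), `e := unrUnit L S`, the guarded read-back (P-e)′ IS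
★ `S10Frozen.toAdelic_ΦGu_unrUnit`; so for every matched pair `Σ'_{c : evp c = t₀} m(c) · Tr c(toAdelic (𝔣.𝔳.ΦGu S e φ)) = Σᶠ_i m(π_i) · Tr [P i](𝔳.ΦG φ)` modulo the two
e.v.p. pins (P-t₀) (P-rig) ONLY — the body of D's `DiscreteCoeffAtT0Hyp L v (mOf 𝔣) (MatchE1 …) (trGPinned 𝔣) cD t₀` at row 3's `cD` read at the unit (`mOf`, `trGPinned` unfold
by `rfl`). [cite: Rogawski1990, §13.8 display (13.8.3) p. 218 L5–7, L24, p. 219 L2–L3; §13.7 line (3) p. 211] [cite: FlathCorvallis1979, Thm. 3] [cite: BorelJacquet1979, §4.1] -/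
theorem discreteCoeffAtT0_frozenFamily_unrUnit_of_letters (𝔣 : S10FrozenDatum L μ v νHv νQv mHv mQv πSt) (S : Set (Pl L)) {Germ : Type*} (t₀ : Germ)
    (evp : (haveI := 𝔣.𝔤.hμG; DiscreteClass (G3 L) 𝔣.𝔤.μG) → Germ)
    (ht₀ : GermOfMembersLetter 𝔣 evp t₀) (hrig : RigidityAtGermLetter 𝔣 evp t₀) :
    haveI := 𝔣.𝔤.hμG
    haveI := 𝔣.𝔤.hνG
    ∀ (fH : HLoc L v → ℂ) (φ : Gqs L v → ℂ), MatchE1 L μ v mHv mQv fH φ →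
      (∑' q : {c : DiscreteClass (G3 L) 𝔣.𝔤.μG // evp c = t₀},
          ((q.1.mult).toNat : ℂ) * q.1.classTrace 𝔣.𝔤.νG (toAdelic (𝔣.𝔳.ΦGu S (unrUnit L S) φ))) =
        ∑ᶠ i : 𝔣.𝔤.ι, (((DiscreteClass.mk (𝔣.𝔤.P i)).mult).toNat : ℂ) * (DiscreteClass.mk (𝔣.𝔤.P i)).classTrace 𝔣.𝔤.νG (𝔣.𝔳.ΦG φ) :=
  discreteCoeffAtT0_frozenDatum_of_letters_smooth 𝔣 toAdelic (𝔣.𝔳.ΦGu S) (unrUnit L S) t₀ evp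
    (fun _ hφ => 𝔣.𝔳.toAdelic_ΦGu_unrUnit S hφ) ht₀ hrig

end Frozen

end Summit.HodgeConjecture.HodgeConjecture.R90.S10

end
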